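import Literature.Analysis.FluidPDE.RieszPressureL3
import Literature.Analysis.FluidPDE.SelfSimilarCollapseAnsatz
import HarnessLib

/-!
# Chae–Shvydkoy 2013: exclusion of a locally self-similar Euler collapse — the `L^p` criterion
# (Thm 3.2), the energy growth bound in the window `3/p < α ≤ 3/2` (Cor 3.4) and the vorticity
# criterion (Thm 4.1); the finite-energy case `α > 3/2` proved

Analysis/FluidPDE statements file (three NAMED FACTS with cite tags; everything else proved, no
`sorry`), typing §3–§4 of

* D. Chae, R. Shvydkoy, *On formation of a locally self-similar collapse in the incompressible
  Euler equations*, Arch. Ration. Mech. Anal. **209** (2013) 999–1017 = arXiv:1201.6009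
  [ChaeShvydkoy2013]. Theorem numbers are those of the held arXiv text (section-wise numbering:
  Thm 2.1, Cor 2.2, Thm 3.1, Thm 3.2, Lemma 3.3, Cor 3.4, Thm 4.1, Thm 4.2),

in dimension `N = 3` and in the vocabulary of the tree's stationary self-similar Euler profiles
(`IsSelfSimilarEulerProfile`, `SelfSimilarEulerProfile.lean`; `selfSimilarCollapse`,
`SelfSimilarCollapseAnsatz.lean`).

## The setting (CS13 §1–§2) and the dictionary to the tree

CS13 (1.2): near a point `x_*` and a time `T` a solution of the incompressible Euler equations
organises into a **locally self-similar collapse**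
`u(x,t) = (T−t)^{−α/(1+α)} v((x−x_*)/(T−t)^{1/(1+α)})`, `p(x,t) = (T−t)^{−2α/(1+α)} q(…)`,
`|x − x_*| < ρ₀`, `α > −1` ("to insure focusing"). This is the tree's power-law ansatz
`selfSimilarCollapse γ T U` (`u(t,x) = (T−t)^{γ−1} U((T−t)^{−γ} x)`, Constantin–Ignatova–Vicol
2026 (3.2)) with **`γ = 1/(α+1)`** (so `γ − 1 = −α/(1+α)`; this `α ↦ 1/(α+1)` is also
`Seregin2023.rateOfAlpha` of `Seregin2023/TypeIIEulerZoom.lean`, whose `eulerZoom α` is the zoom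
that fixes exactly these fields), and the profile pair `(U, P) = (v, q)` solves the tree's
stationary self-similar Euler system `IsSelfSimilarEulerProfile γ 0 U P` (CIV (3.3)):
`(1−γ) U + DU(y)[γ y + U(y)] + ∇P = 0`, `div U = 0`, i.e. `α/(1+α) v + 1/(1+α) (y·∇)v + (v·∇)v + ∇q = 0`
(substitute the ansatz into `uₜ + u·∇u + ∇p = 0`; the tree's
`IsSelfSimilarEulerProfile.euler_selfSimilarCollapse` is the converse direction "profile ⇒ Euler
solution below `T`").

**Sign convention of the printed profile system.** CS13 display (2.1) reads
`1/(1+α) y·∇v + α/(1+α) v = v·∇v + ∇q`; it is written after the paper's normalisation "`T = 0`,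
while `t > 0`" (§2.2), i.e. for the TIME-REVERSED (defocusing) field `u(x,t) = t^{−α/(1+α)} v(x/t^{1/(1+α)})`,
`t > 0`, whose profile is `v = −U` (Euler's symmetry `u(x,t) ↦ −u(x,−t)`; the pressure profile is
unchanged). The lemma `chaeShvydkoy_profileEq_iff_neg` below checks this letter for letter:
`(v, q)` solves the printed (2.1) iff `(−v, q)` satisfies the `profile_eq` clause of
`IsSelfSimilarEulerProfile (1/(α+1)) 0`. Every hypothesis and every conclusion of the theorems
typed here (`v ∈ L^p`, `v ∈ C¹_loc`, the associated pressure — quadratic in `v` —, `ω ∈ L^p`,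
`|ς| = o(1)`, "`v = 0`", "`v` is constant") is invariant under `v ↦ −v`, so the statements below,
made for the collapse profile `U`, are the printed ones.

**"The pressure `q` is given by (2.3)"** (the *associated pressure*
`q = −|v|²/N + P.V.∫ K_{ij}(y−z) v_i v_j(z) dz = ℛᵢℛⱼ(vᵢvⱼ)`; CS13 §2.1: "If `v ∈ L^p`,
`2 < p < ∞` … and `q ∈ L^{p/2}` …, then there is only one solution to [the Poisson equation
`Δq = −∂ᵢ∂ⱼ(vᵢvⱼ)`] given by (2.3)"; the hypothesis is NOT redundant — CS13 (2.4): `v ≡ e₁`,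
`q = α/(1+α) y₁` solves (2.1) for every `α > −1`). Rendered, for `3 ≤ p < ∞`, exactly by that
uniqueness remark: `P ∈ L^{p/2}(ℝ³)` AND the weak Poisson equation
`∫ P Δφ = −∫ D²φ(U, U)` for every test function `φ` — the tree's rendering of
`ΔΠ = −∂ᵢ∂ⱼ(wᵢwⱼ)` (`integral_rieszPressure_mul_laplacian`, `RieszPressureL3.lean`); for `p = 3`
this says `P = Π[U]` a.e. (`ae_eq_rieszPressure_of_forall_integral_mul_laplacian`,
`RieszPressureLocality.lean`), see `chaeShvydkoy2013_Lp_exclusion.of_rieszPressure`.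

**Regularity.** CS13 assume `v ∈ C¹_loc` ("only needed for the local energy equality to hold")
and a distributional solution; the tree's profile structure asks `U ∈ C²`, `P ∈ C¹` and the
profile equation pointwise. The facts below are therefore the printed theorems RESTRICTED to
`C²` profiles (a special case; nothing is claimed for rougher profiles).
-- TODO(general form): `C¹_loc` profiles / general dimension `N` / the case `p = ∞`, `q ∈ BMO`
-- of Thm 3.2 (§3.2.4) are not typed (no `BMO` in Mathlib; no consumer).

## Contents

* `chaeShvydkoy_profileEq_iff_neg`, `isSelfSimilarEulerProfile_neg_iff_chaeShvydkoy` — the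
  dictionary between the printed system (2.1) and `IsSelfSimilarEulerProfile` (proved).
* FACT `chaeShvydkoy2013_Lp_exclusion` — **Theorem 3.2**: `v ∈ L^p ∩ C¹_loc`, `3 ≤ p < ∞`
  [printed: `≤ ∞`], associated pressure, and `−1 < α ≤ 3/p` or `α > 3/2` ⇒ `v = 0`.
* FACT `chaeShvydkoy2013_energy_growth` — **Corollary 3.4**: same standing hypotheses and
  `3/p < α ≤ 3/2` ⇒ `∫_{|y| ≤ L} |v|² ≲ L^{3−2α}` (CS13 (1.3), "a natural internal feature of the
  blow-up, independent of the total energy assumption").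
* FACT `chaeShvydkoy2013_vorticity_exclusion` — **Theorem 4.1**: `α > −1`, strain
  `|ς(y)| = o(1)` at infinity, `ω ∈ L^p` for some `0 < p < 3/(1+α)` ⇒ `v` is a constant vector.
* PROVED (CS13 §1, display (1.3), and the first clause of **Corollary 2.2** / the range `α > N/2`
  of Thm 3.2 under finite energy: "if the total energy of `u` is finite, then by rescaling the
  energy in the ball `|x − x_*| ≤ ρ₀` we have the bound `∫_{|y|<Lρ₀} |v|² ≲ L^{N−2α}` … Therefore
  the case `α > N/2` is automatically excluded"):
  `setIntegral_norm_sq_selfSimilarCollapse_ball` (energy of the ansatz in a ball, exact scaling),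
  `energyGrowth_of_selfSimilarCollapse_energy_le` ((1.3) from a local energy bound),
  `eq_zero_of_energyGrowth_of_three_halves_lt` (`α > 3/2` + (1.3) ⇒ `U = 0` for continuous `U`),
  `selfSimilarCollapse_profile_eq_zero_of_energy_le` (the two combined).
* PROVED `chaeShvydkoy2013_Lp_exclusion.of_rieszPressure` — Thm 3.2 at `p = 3` ("This includes
  the `L³` case natural for the Navier–Stokes equations", CS13 abstract) with the associated
  pressure written as the tree's Riesz pressure `Π[U]`.

Deliberately NOT here (no consumer names them; ask the literature seat): Thm 2.1 / Cor 2.2 in the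
class `C^w_t L²_x ∩ L³_t L³_x` (global energy equality), Thm 3.1 (`α = 3/2` with the power spread
(3.1): its pressure is the principal-value formula (2.3) for an `L² ∩ C¹` field, not a tree
object), Lemma 3.3, Thm 4.2 (homogeneous-near-infinity profiles; derivable from 3.2/3.4/4.1 and
the harmonic Liouville theorem as printed), the explicit singular examples (2.4)–(2.7).

## Use

Route `EulerZoomLiouville` (summit NavierStokesRegularity; §B Type-II-exclusion ideation): its
attacked conjunct `PowerGaugeEulerLiouville` (Liouville for ancient local-energy Euler flows in
Seregin's power-gauged class, `F(a) = a^ρ`) has as formal members the exact self-similar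
collapses with `α = 1 + ρ ∈ (1, 3/2]` — the window `3/p < α ≤ 3/2` (`p = 3`) left open by
Theorem 3.2 and in which Corollary 3.4 supplies exactly the `A`-type gauge growth
`∫_{B_L}|U|² ≲ L^{3−2α}`; Theorem 4.1 is the printed in-window criterion. Users take
`(h : chaeShvydkoy2013_Lp_exclusion)` etc. as hypotheses (D-0014 named facts).

## Mathlib / tree search

`lean search 'Shvydkoy|chaeShvydkoy' --decl`: no Chae–Shvydkoy 2013 statement in the tree (only
docstring citations in `Seregin2023/TypeIIEulerZoom.lean`, `DecayingSelfSimilarEulerProfile.lean`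
and several Theses). Reused: `IsSelfSimilarEulerProfile` (+ `.zero`), `selfSimilarCollapse`,
`curl`, `VectorCalculus.IsDivFree`, `rieszPressure` / `memLp_rieszPressure` /
`integral_rieszPressure_mul_laplacian`; Mathlib `Measure.setIntegral_comp_smul_of_pos`,
`smul_ball`, `finrank_euclideanSpace_fin`, `tendsto_rpow_neg_atTop`,
`integral_eq_zero_iff_of_nonneg`, `ae_eq_restrict_iUnion_iff`, `Continuous.ae_eq_iff_eq`,
the `Laplacian` notation `Δ`, `ContinuousLinearMap.adjoint` (strain `½(DU + DUᵀ)`).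
No new definitions with arguments, no instances, no notation.
-/

noncomputable section

open MeasureTheory Set Filter Topology Metric Laplacian
open scoped ENNReal NNReal Pointwise

namespace Literature.Analysis.FluidPDE

/-! ## The printed profile system (2.1) versus `IsSelfSimilarEulerProfile` -/

/-- **Dictionary, pointwise.** For `α ≠ −1` and any `v`, `q`, `y`: the printed Chae–Shvydkoy
profile system (2.1) `1/(1+α) (y·∇)v + α/(1+α) v = (v·∇)v + ∇q` holds at `y` for `(v, q)` iff the
`profile_eq` clause of `IsSelfSimilarEulerProfile (1/(α+1)) 0` (CIV (3.3),
`(1−γ)U + DU(y)[γ(y − 0) + U(y)] + ∇P = 0`) holds at `y` for the time-reversed pair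
`(U, P) = (−v, q)`. Pure linear algebra (`D(−v) = −Dv`). [cite: ChaeShvydkoy2013, §2.1 eq. (2.1)] -/
theorem chaeShvydkoy_profileEq_iff_neg {α : ℝ} (hα : α + 1 ≠ 0)
    (v : EuclideanSpace ℝ (Fin 3) → EuclideanSpace ℝ (Fin 3)) (q : EuclideanSpace ℝ (Fin 3) → ℝ)
    (y : EuclideanSpace ℝ (Fin 3)) :
    (1 / (α + 1)) • fderiv ℝ v y y + (α / (α + 1)) • v y = fderiv ℝ v y (v y) + gradient q y ↔
      (1 - 1 / (α + 1)) • (-v) y + fderiv ℝ (-v) y ((1 / (α + 1)) • (y - 0) + (-v) y) +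
          gradient q y = 0 := by
  have hcoef : (1 - 1 / (α + 1) : ℝ) = α / (α + 1) := by
    field_simp
    ring
  have key : (1 - 1 / (α + 1)) • (-v) y + fderiv ℝ (-v) y ((1 / (α + 1)) • (y - 0) + (-v) y) +
      gradient q y =
      -(((1 / (α + 1)) • fderiv ℝ v y y + (α / (α + 1)) • v y) -
        (fderiv ℝ v y (v y) + gradient q y)) := by
    rw [hcoef, fderiv_neg, sub_zero]
    simp only [Pi.neg_apply, neg_apply, map_add, map_smul, map_neg, smul_neg]
    abel
  rw [key, neg_eq_zero, sub_eq_zero]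

/-- **Dictionary, structure level.** `(−v, q)` is a stationary self-similar Euler profile of the
tree with exponent `γ = 1/(α+1)` and centre `0` iff `v ∈ C²`, `q ∈ C¹`, `(v, q)` solves the
printed system (2.1) at every point and `div v = 0`. [cite: ChaeShvydkoy2013, §2.1 eq. (2.1)] -/
theorem isSelfSimilarEulerProfile_neg_iff_chaeShvydkoy {α : ℝ} (hα : α + 1 ≠ 0)
    (v : EuclideanSpace ℝ (Fin 3) → EuclideanSpace ℝ (Fin 3)) (q : EuclideanSpace ℝ (Fin 3) → ℝ) :
    IsSelfSimilarEulerProfile (1 / (α + 1)) 0 (-v) q ↔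
      ContDiff ℝ 2 v ∧ ContDiff ℝ 1 q ∧
        (∀ y, (1 / (α + 1)) • fderiv ℝ v y y + (α / (α + 1)) • v y =
          fderiv ℝ v y (v y) + gradient q y) ∧
        VectorCalculus.IsDivFree v := by
  have hdiv : VectorCalculus.IsDivFree (-v) ↔ VectorCalculus.IsDivFree v := by
    simp only [VectorCalculus.IsDivFree, VectorCalculus.divergence, fderiv_neg,
      ContinuousLinearMap.toLinearMap_neg, map_neg, neg_eq_zero]
  have hC2 : ContDiff ℝ 2 (-v) ↔ ContDiff ℝ 2 v :=
    ⟨fun h => by simpa using h.neg, fun h => h.neg⟩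
  constructor
  · intro h
    exact ⟨hC2.1 h.contDiff_velocity, h.contDiff_pressure,
      fun y => (chaeShvydkoy_profileEq_iff_neg hα v q y).2 (h.profile_eq y), hdiv.1 h.divFree⟩
  · rintro ⟨hv, hq, heq, hd⟩
    exact ⟨hC2.2 hv, hq, fun y => (chaeShvydkoy_profileEq_iff_neg hα v q y).1 (heq y), hdiv.2 hd⟩

/-! ## The three named facts (CS13 Thm 3.2, Cor 3.4, Thm 4.1) -/

/-- **Chae–Shvydkoy 2013, Theorem 3.2** (`N = 3`, `C²` profiles, `p < ∞`). Printed: "Suppose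
`v ∈ L^p ∩ C¹_loc` for some `3 ≤ p ≤ ∞`, and `q` is given by (2.3). If `−1 < α ≤ N/p` or
`N/2 < α`, then `v = 0`." Here, for the collapse profile `(U, P)` (see the module docstring for
the sign dictionary): `(U, P)` is a stationary self-similar Euler profile with exponent
`γ = 1/(α+1)` and centre `0` (`IsSelfSimilarEulerProfile`: `U ∈ C²`, `P ∈ C¹`,
`α/(1+α) U + 1/(1+α) (y·∇)U + (U·∇)U + ∇P = 0`, `div U = 0`), `U ∈ L^p(ℝ³)` with `3 ≤ p < ∞`,
`P` is the associated pressure (`P ∈ L^{p/2}` and `ΔP = −∂ᵢ∂ⱼ(UᵢUⱼ)` weakly — CS13 §2.1), and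
`−1 < α ≤ 3/p` or `3/2 < α`; then `U = 0`. The scaling `α = N/p` conserves `‖u(t)‖_{L^p}`; the
range `3/p < α ≤ 3/2` is NOT covered ("It is precisely for `N/p < α ≤ N/2` when this algorithm
fails", §1) — there Cor 3.4 (`chaeShvydkoy2013_energy_growth`) holds instead.
[cite: ChaeShvydkoy2013, §3.2 Thm. 3.2] -/
def chaeShvydkoy2013_Lp_exclusion : Prop :=
  ∀ (α : ℝ) (p : ℝ≥0∞) (U : EuclideanSpace ℝ (Fin 3) → EuclideanSpace ℝ (Fin 3))
    (P : EuclideanSpace ℝ (Fin 3) → ℝ),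
    -1 < α → 3 ≤ p → p ≠ ∞ → (α ≤ 3 / p.toReal ∨ 3 / 2 < α) →
    IsSelfSimilarEulerProfile (1 / (α + 1)) 0 U P →
    MemLp U p volume → MemLp P (p / 2) volume →
    (∀ φ : EuclideanSpace ℝ (Fin 3) → ℝ, ContDiff ℝ (⊤ : ℕ∞) φ → HasCompactSupport φ →
      ∫ x, P x * (Δ φ) x = -∫ x, fderiv ℝ (fderiv ℝ φ) x (U x) (U x)) →
    U = 0

/-- **Chae–Shvydkoy 2013, Corollary 3.4** (`N = 3`, `C²` profiles, `p < ∞`): under the standing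
hypotheses of Theorem 3.2 (`v ∈ L^p ∩ C¹_loc`, `3 ≤ p`, associated pressure) and in the window
`N/p < α ≤ N/2`, "one has `∫_{|y| ≤ L} |v|² dy ≲ L^{N−2α}`" (display (3.20) = (1.3), for all large
`L`) — "the energy growth bound (1.3) is a natural internal feature of the blow-up, independent of
the total energy assumption. In particular, if `v ∈ L^p`, `p ≥ 3`, and `α = N/2`, then
automatically `v ∈ L²`" (§1). Rendered for the collapse profile `(U, P)`, with `∃ C L₀, ∀ L ≥ L₀`.
[cite: ChaeShvydkoy2013, §3.2.3 Cor. 3.4] -/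
def chaeShvydkoy2013_energy_growth : Prop :=
  ∀ (α : ℝ) (p : ℝ≥0∞) (U : EuclideanSpace ℝ (Fin 3) → EuclideanSpace ℝ (Fin 3))
    (P : EuclideanSpace ℝ (Fin 3) → ℝ),
    3 ≤ p → p ≠ ∞ → 3 / p.toReal < α → α ≤ 3 / 2 →
    IsSelfSimilarEulerProfile (1 / (α + 1)) 0 U P →
    MemLp U p volume → MemLp P (p / 2) volume →
    (∀ φ : EuclideanSpace ℝ (Fin 3) → ℝ, ContDiff ℝ (⊤ : ℕ∞) φ → HasCompactSupport φ →
      ∫ x, P x * (Δ φ) x = -∫ x, fderiv ℝ (fderiv ℝ φ) x (U x) (U x)) →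
    ∃ C L₀ : ℝ, 0 < L₀ ∧ ∀ L : ℝ, L₀ ≤ L →
      ∫ y in ball (0 : EuclideanSpace ℝ (Fin 3)) L, ‖U y‖ ^ 2 ≤ C * L ^ (3 - 2 * α)

/-- **Chae–Shvydkoy 2013, Theorem 4.1** (`N = 3`, `C²` profiles). Printed: "Suppose
`v ∈ C¹_loc(ℝ^N)` is a solution with `α > −1` satisfying (i) `|ς(y)| = o(1)` as `|y| → ∞`
[`ς = ½(∂ᵢvⱼ + ∂ⱼvᵢ)` the strain tensor], (ii) `ω ∈ L^p` for some `0 < p < N/(1+α)`. Then `v` is a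
constant vector field." No pressure condition (the constant flow (2.4) with its linear pressure is
allowed by the conclusion); `p < 1` is admissible. Rendered for the collapse profile: a stationary
self-similar Euler profile `(U, P)` with exponent `1/(α+1)`, centre `0`, whose strain
`½(DU(y) + DU(y)ᵀ)` tends to `0` in operator norm along the cocompact filter of `ℝ³` and whose
vorticity `curl U` lies in `L^p(ℝ³)` for some real `0 < p < 3/(1+α)`, is constant. The exponent
`3/(1+α)` is "critical for the fact that the vorticity of the self-similar solution preserves this
particular `L^p`-norm". [cite: ChaeShvydkoy2013, §4 Thm. 4.1] -/
def chaeShvydkoy2013_vorticity_exclusion : Prop :=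
  ∀ (α p : ℝ) (U : EuclideanSpace ℝ (Fin 3) → EuclideanSpace ℝ (Fin 3))
    (P : EuclideanSpace ℝ (Fin 3) → ℝ),
    -1 < α → 0 < p → p < 3 / (1 + α) →
    IsSelfSimilarEulerProfile (1 / (α + 1)) 0 U P →
    Tendsto (fun y => ‖(1 / 2 : ℝ) • (fderiv ℝ U y + ContinuousLinearMap.adjoint (fderiv ℝ U y))‖)
      (cocompact (EuclideanSpace ℝ (Fin 3))) (𝓝 0) →
    MemLp (curl U) (ENNReal.ofReal p) volume →
    ∃ b : EuclideanSpace ℝ (Fin 3), ∀ y, U y = b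

/-! ## Proved: the energy of the ansatz in a ball, CS13 (1.3), and the finite-energy exclusion of
`α > 3/2` -/

/-- **Energy of the ansatz in a ball (exact scaling).** For `t < T` and any radius `ρ`,
`∫_{|x|<ρ} |u(t,x)|² dx = (T−t)^{2(γ−1)+3γ} ∫_{|y| < ρ(T−t)^{−γ}} |U(y)|² dy` for
`u = selfSimilarCollapse γ T U` (change of variables `y = (T−t)^{−γ} x` in `ℝ³`; CS13 §1, the
computation behind (1.3): with `γ = 1/(α+1)` the exponent is `(N−2α)/(1+α)`, cf. (2.9)).
[cite: ChaeShvydkoy2013, §1 eq. (1.3)] -/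
theorem setIntegral_norm_sq_selfSimilarCollapse_ball {γ T t : ℝ} (ht : t < T)
    (U : EuclideanSpace ℝ (Fin 3) → EuclideanSpace ℝ (Fin 3)) (ρ : ℝ) :
    ∫ x in ball (0 : EuclideanSpace ℝ (Fin 3)) ρ, ‖selfSimilarCollapse γ T U t x‖ ^ 2 =
      (T - t) ^ (2 * (γ - 1) + 3 * γ) *
        ∫ y in ball (0 : EuclideanSpace ℝ (Fin 3)) (ρ * (T - t) ^ (-γ)), ‖U y‖ ^ 2 := by
  have hs : 0 < T - t := sub_pos.mpr ht
  have hR : 0 < (T - t) ^ (-γ) := Real.rpow_pos_of_pos hs _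
  have h1 : ∀ x : EuclideanSpace ℝ (Fin 3), ‖selfSimilarCollapse γ T U t x‖ ^ 2 =
      (T - t) ^ (2 * (γ - 1)) * ‖U ((T - t) ^ (-γ) • x)‖ ^ 2 := by
    intro x
    rw [norm_selfSimilarCollapse ht, mul_pow, ← Real.rpow_natCast ((T - t) ^ (γ - 1)) 2,
      ← Real.rpow_mul hs.le]
    congr 2
    push_cast
    ring
  simp_rw [h1]
  rw [integral_const_mul,
    Measure.setIntegral_comp_smul_of_pos volume (fun y : EuclideanSpace ℝ (Fin 3) => ‖U y‖ ^ 2)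
      (ball (0 : EuclideanSpace ℝ (Fin 3)) ρ) hR,
    smul_ball hR.ne' (0 : EuclideanSpace ℝ (Fin 3)) ρ, smul_zero, Real.norm_of_nonneg hR.le,
    finrank_euclideanSpace_fin, smul_eq_mul, mul_comm ((T - t) ^ (-γ)) ρ, ← mul_assoc]
  congr 1
  rw [← Real.rpow_natCast ((T - t) ^ (-γ)) 3, ← Real.rpow_mul hs.le, ← Real.rpow_neg hs.le,
    ← Real.rpow_add hs]
  congr 1
  push_cast
  ring

/-- **CS13 (1.3): a local energy bound near the collapse forces the energy growth
`∫_{|y| < L} |U|² ≤ E₀ ρ^{2α−3} L^{3−2α}` on the profile.** If the ansatz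
`u = selfSimilarCollapse (1/(α+1)) T U`, `α > −1`, has `∫_{|x|<ρ} |u(t,x)|² dx ≤ E₀` for all
`t ∈ [t₀, T)` (e.g. a locally self-similar collapse embedded in a finite-energy flow), then for
every `L ≥ ρ (T−t₀)^{−1/(α+1)}` one has `∫_{|y|<L} |U|² ≤ E₀ ρ^{2α−3} L^{3−2α}` — "by rescaling the
energy in the ball `|x − x_*| ≤ ρ₀`, we have the bound `∫_{|y|<Lρ₀} |v(y)|² ≲ L^{N−2α}` for all
`L > L₀`". [cite: ChaeShvydkoy2013, §1 eq. (1.3)] -/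
theorem energyGrowth_of_selfSimilarCollapse_energy_le {α T t₀ ρ E₀ : ℝ} (hα : -1 < α)
    (ht₀ : t₀ < T) (hρ : 0 < ρ) (U : EuclideanSpace ℝ (Fin 3) → EuclideanSpace ℝ (Fin 3))
    (hE : ∀ t ∈ Ico t₀ T,
      ∫ x in ball (0 : EuclideanSpace ℝ (Fin 3)) ρ,
        ‖selfSimilarCollapse (1 / (α + 1)) T U t x‖ ^ 2 ≤ E₀)
    {L : ℝ} (hL : ρ * (T - t₀) ^ (-(1 / (α + 1))) ≤ L) :
    ∫ y in ball (0 : EuclideanSpace ℝ (Fin 3)) L, ‖U y‖ ^ 2 ≤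
      E₀ * ρ ^ (2 * α - 3) * L ^ (3 - 2 * α) := by
  have hα1 : 0 < α + 1 := by linarith
  have hs₀ : 0 < T - t₀ := sub_pos.mpr ht₀
  have hpow₀ : 0 < (T - t₀) ^ (-(1 / (α + 1))) := Real.rpow_pos_of_pos hs₀ _
  have hLpos : 0 < L := (mul_pos hρ hpow₀).trans_le hL
  have hq : 0 < L / ρ := div_pos hLpos hρ
  -- the time `T - s` at which the self-similar ball `|y| < ρ (T−t)^{−γ}` has radius `L`
  set s : ℝ := (L / ρ) ^ (-(α + 1)) with hs_def
  have hs : 0 < s := Real.rpow_pos_of_pos hq _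
  have hqge : (T - t₀) ^ (-(1 / (α + 1))) ≤ L / ρ := by
    rw [le_div_iff₀ hρ, mul_comm]
    exact hL
  have hsle : s ≤ T - t₀ := by
    have h1 : (L / ρ) ^ (-(α + 1)) ≤ ((T - t₀) ^ (-(1 / (α + 1)))) ^ (-(α + 1)) :=
      Real.rpow_le_rpow_of_nonpos hpow₀ hqge (by linarith)
    have h2 : ((T - t₀) ^ (-(1 / (α + 1)))) ^ (-(α + 1)) = T - t₀ := by
      rw [← Real.rpow_mul hs₀.le]
      have : -(1 / (α + 1)) * -(α + 1) = 1 := by field_simp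
      rw [this, Real.rpow_one]
    rw [h2] at h1
    exact h1
  have hts : T - (T - s) = s := by ring
  have hEt := hE (T - s) ⟨by linarith, by linarith⟩
  rw [setIntegral_norm_sq_selfSimilarCollapse_ball (by linarith : T - s < T) U ρ, hts] at hEt
  -- radius: `ρ s^{−γ} = L`
  have hrad : ρ * s ^ (-(1 / (α + 1))) = L := by
    rw [hs_def, ← Real.rpow_mul hq.le]
    have : -(α + 1) * -(1 / (α + 1)) = 1 := by field_simp
    rw [this, Real.rpow_one]
    field_simp
  -- prefactor: `s^{2(γ−1)+3γ} = (L/ρ)^{2α−3}`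
  have hpre : s ^ (2 * (1 / (α + 1) - 1) + 3 * (1 / (α + 1))) = (L / ρ) ^ (2 * α - 3) := by
    rw [hs_def, ← Real.rpow_mul hq.le]
    congr 1
    field_simp
    ring
  rw [hrad, hpre] at hEt
  have hfac : 0 < (L / ρ) ^ (2 * α - 3) := Real.rpow_pos_of_pos hq _
  rw [mul_comm] at hEt
  have hle : ∫ y in ball (0 : EuclideanSpace ℝ (Fin 3)) L, ‖U y‖ ^ 2 ≤
      E₀ / (L / ρ) ^ (2 * α - 3) := (le_div_iff₀ hfac).2 hEt
  calc ∫ y in ball (0 : EuclideanSpace ℝ (Fin 3)) L, ‖U y‖ ^ 2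
      ≤ E₀ / (L / ρ) ^ (2 * α - 3) := hle
    _ = E₀ * ρ ^ (2 * α - 3) * L ^ (3 - 2 * α) := by
        rw [Real.div_rpow hLpos.le hρ.le, div_div_eq_mul_div, div_eq_mul_inv,
          ← Real.rpow_neg hLpos.le, show -(2 * α - 3) = 3 - 2 * α by ring]

/-- **The range `α > N/2 = 3/2` is excluded by the energy growth bound** (CS13 §1: "Therefore,
the case `α > N/2` is automatically excluded"; Cor. 2.2, first clause): a continuous field whose
energy in balls obeys `∫_{|y|<L} |U|² ≤ C L^{3−2α}` for all large `L`, with `3/2 < α`, vanishes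
identically (the bound tends to `0` while the ball energies increase).
[cite: ChaeShvydkoy2013, §1 (after eq. (1.3)) and §2.3 Cor. 2.2] -/
theorem eq_zero_of_energyGrowth_of_three_halves_lt {α C L₀ : ℝ} (hα : 3 / 2 < α)
    {U : EuclideanSpace ℝ (Fin 3) → EuclideanSpace ℝ (Fin 3)} (hU : Continuous U)
    (hgrowth : ∀ L : ℝ, L₀ ≤ L →
      ∫ y in ball (0 : EuclideanSpace ℝ (Fin 3)) L, ‖U y‖ ^ 2 ≤ C * L ^ (3 - 2 * α)) :
    U = 0 := by
  have hint : ∀ L : ℝ, IntegrableOn (fun y => ‖U y‖ ^ 2) (ball (0 : EuclideanSpace ℝ (Fin 3)) L)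
      volume := fun L =>
    ((hU.norm.pow 2).continuousOn.integrableOn_compact (isCompact_closedBall 0 L)).mono_set
      ball_subset_closedBall
  -- every ball energy vanishes
  have hzero : ∀ L₁ : ℝ, ∫ y in ball (0 : EuclideanSpace ℝ (Fin 3)) L₁, ‖U y‖ ^ 2 = 0 := by
    intro L₁
    have hnn : 0 ≤ ∫ y in ball (0 : EuclideanSpace ℝ (Fin 3)) L₁, ‖U y‖ ^ 2 :=
      integral_nonneg fun y => by positivity
    refine le_antisymm ?_ hnn
    have hlim : Tendsto (fun L : ℝ => C * L ^ (3 - 2 * α)) atTop (𝓝 0) := by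
      have h := (tendsto_rpow_neg_atTop (y := 2 * α - 3) (by linarith)).const_mul C
      rw [mul_zero] at h
      refine h.congr fun L => ?_
      rw [show -(2 * α - 3) = 3 - 2 * α by ring]
    refine ge_of_tendsto hlim ?_
    filter_upwards [eventually_ge_atTop (max L₀ L₁)] with L hL
    have hL₀ : L₀ ≤ L := (le_max_left _ _).trans hL
    have hL₁ : L₁ ≤ L := (le_max_right _ _).trans hL
    calc ∫ y in ball (0 : EuclideanSpace ℝ (Fin 3)) L₁, ‖U y‖ ^ 2
        ≤ ∫ y in ball (0 : EuclideanSpace ℝ (Fin 3)) L, ‖U y‖ ^ 2 :=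
          setIntegral_mono_set (hint L) (ae_of_all _ fun y => by positivity)
            (ae_of_all _ (ball_subset_ball hL₁))
      _ ≤ C * L ^ (3 - 2 * α) := hgrowth L hL₀
  -- hence `U = 0` a.e. on every ball, a.e. on `ℝ³`, and everywhere by continuity
  have hae : ∀ n : ℕ, U =ᵐ[volume.restrict (ball (0 : EuclideanSpace ℝ (Fin 3)) n)] 0 := by
    intro n
    have h0 := (integral_eq_zero_iff_of_nonneg (fun y => by positivity) (hint n)).1 (hzero n)
    filter_upwards [h0] with y hy
    simpa using hy
  have hae' : U =ᵐ[volume] 0 := by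
    have h := (ae_eq_restrict_iUnion_iff (μ := volume)
      (fun n : ℕ => ball (0 : EuclideanSpace ℝ (Fin 3)) n) U 0).2 hae
    rwa [iUnion_ball_nat, Measure.restrict_univ] at h
  exact (hU.ae_eq_iff_eq volume continuous_zero).1 hae'

/-- **Finite local energy excludes a self-similar collapse with `α > 3/2`** (CS13 §1 / Cor. 2.2
first clause, proved): if the ansatz `u = selfSimilarCollapse (1/(α+1)) T U` with a continuous
profile `U` and `α > 3/2` has bounded energy `∫_{|x|<ρ} |u(t)|² ≤ E₀` in a fixed ball for all
`t ∈ [t₀, T)`, then `U = 0`. [cite: ChaeShvydkoy2013, §1 eq. (1.3) and §2.3 Cor. 2.2] -/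
theorem selfSimilarCollapse_profile_eq_zero_of_energy_le {α T t₀ ρ E₀ : ℝ} (hα : 3 / 2 < α)
    (ht₀ : t₀ < T) (hρ : 0 < ρ) {U : EuclideanSpace ℝ (Fin 3) → EuclideanSpace ℝ (Fin 3)}
    (hU : Continuous U)
    (hE : ∀ t ∈ Ico t₀ T,
      ∫ x in ball (0 : EuclideanSpace ℝ (Fin 3)) ρ,
        ‖selfSimilarCollapse (1 / (α + 1)) T U t x‖ ^ 2 ≤ E₀) :
    U = 0 :=
  eq_zero_of_energyGrowth_of_three_halves_lt (C := E₀ * ρ ^ (2 * α - 3))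
    (L₀ := ρ * (T - t₀) ^ (-(1 / (α + 1)))) hα hU
    fun _ hL => energyGrowth_of_selfSimilarCollapse_energy_le (by linarith) ht₀ hρ U hE hL

/-- The same for a stationary self-similar Euler profile of the tree (`U ∈ C²` is continuous): an
exact self-similar Euler collapse with exponent `α > 3/2` (`γ = 1/(α+1) < 2/5`) and bounded
energy in a fixed ball up to the blow-up time has the trivial profile — the energy-supercritical
half of CS13 Thm 3.2 needs no `L^p` hypothesis and no pressure formula once the collapse sits in
a locally-finite-energy flow. [cite: ChaeShvydkoy2013, §1 eq. (1.3) and §2.3 Cor. 2.2] -/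
theorem IsSelfSimilarEulerProfile.eq_zero_of_energy_le_of_three_halves_lt {α T t₀ ρ E₀ : ℝ}
    {U : EuclideanSpace ℝ (Fin 3) → EuclideanSpace ℝ (Fin 3)} {P : EuclideanSpace ℝ (Fin 3) → ℝ}
    (h : IsSelfSimilarEulerProfile (1 / (α + 1)) 0 U P) (hα : 3 / 2 < α) (ht₀ : t₀ < T)
    (hρ : 0 < ρ)
    (hE : ∀ t ∈ Ico t₀ T,
      ∫ x in ball (0 : EuclideanSpace ℝ (Fin 3)) ρ,
        ‖selfSimilarCollapse (1 / (α + 1)) T U t x‖ ^ 2 ≤ E₀) :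
    U = 0 :=
  selfSimilarCollapse_profile_eq_zero_of_energy_le hα ht₀ hρ h.contDiff_velocity.continuous hE

/-! ## Proved: the `L³` case of Theorem 3.2 with the tree's Riesz pressure -/

/-- **Theorem 3.2 at `p = 3`** ("This includes the `L³` case natural for the Navier–Stokes
equations", CS13 abstract), with the associated pressure written as the tree's Riesz pressure:
given the fact `chaeShvydkoy2013_Lp_exclusion`, a stationary self-similar Euler profile `(U, P)`
with exponent `1/(α+1)`, `U ∈ L³(ℝ³)`, `P = Π[U]` a.e. (`rieszPressure`, `RieszPressureL3.lean`),
and `−1 < α ≤ 1` or `α > 3/2`, is trivial. (`Π[U] ∈ L^{3/2}` and `ΔΠ[U] = −∂ᵢ∂ⱼ(UᵢUⱼ)` weakly are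
the tree's `memLp_rieszPressure`, `integral_rieszPressure_mul_laplacian`.)
[cite: ChaeShvydkoy2013, §3.2 Thm. 3.2] -/
theorem chaeShvydkoy2013_Lp_exclusion.of_rieszPressure (h : chaeShvydkoy2013_Lp_exclusion)
    {α : ℝ} {U : EuclideanSpace ℝ (Fin 3) → EuclideanSpace ℝ (Fin 3)}
    {P : EuclideanSpace ℝ (Fin 3) → ℝ} (hα : -1 < α) (hrange : α ≤ 1 ∨ 3 / 2 < α)
    (hprof : IsSelfSimilarEulerProfile (1 / (α + 1)) 0 U P) (hU3 : MemLp U 3 volume)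
    (hP : P =ᵐ[volume] rieszPressure U) : U = 0 := by
  refine h α 3 U P hα le_rfl (by norm_num) ?_ hprof hU3 ?_ ?_
  · have h3 : (3 : ℝ) / (3 : ℝ≥0∞).toReal = 1 := by norm_num
    rw [h3]
    exact hrange
  · exact (memLp_rieszPressure hU3).ae_eq hP.symm
  · intro φ hφ hφc
    rw [← integral_rieszPressure_mul_laplacian hU3 hφ hφc]
    exact integral_congr_ae (by filter_upwards [hP] with x hx using by rw [hx])

end Literature.Analysis.FluidPDE
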